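import Literature.Analysis.FluidPDE.OnsagerCCFSTestField
import Literature.Analysis.FluidPDE.OnsagerCCFSFluxEstimateProofs
import Literature.Analysis.FluidPDE.OnsagerCCFSEnergyProofs
import Literature.Analysis.FluidPDE.OnsagerCCFSReduction
import HarnessLib

/-!
# Sharp Onsager rigidity on `T³` (Cheskidov–Constantin–Friedlander–Shvydkoy 2008, Thm 3.3) — discharge

Sorry-free proof `Literature.Analysis.FluidPDE.onsager_rigidity_ccfs_holds` of the named fact
`Literature.Analysis.FluidPDE.onsager_rigidity_ccfs` of `Literature/Analysis/FluidPDE/Onsager`: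

> CCFS 2008, Thm 3.3 (first sentence). *The energy of every weak solution `u` of the Euler
> equations on `T^d × (0,T)` with `u ∈ L³(0,T; B^{1/3}_{3,c(ℕ)})` is conserved* — in the tree's
> transcription: `u ∈ L³_t B^{1/3}_{3,c₀}` (difference-quotient form, `MemL3tBesovThirdVanishing`)
> and `IsWeakEulerSolution T u` imply that `t ↦ E(u(t))` is a.e. equal to a constant on `(0,T)`.

The proof is the assembly `Turb.onsager_rigidity_ccfs_of` (`OnsagerCCFSReduction`: du
Bois-Reymond, `FunctionSpaces/DistributionalConstancy`) of the three analytic inputs of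
`OnsagerCCFSFlux`, each discharged in its own file:

* F₁ `Torus.energyBalance_vecConv_holds` (`OnsagerCCFSTestField`): the mollified energy balance,
  CCFS (11), by testing the weak formulation with doubly mollified cut-off fields;
* F₃ `Torus.tendsto_lintegral_cetFlux_holds` (`OnsagerCCFSFluxEstimateProofs`): the flux
  `∫₀ᵀ |Π_{K_ε}[u(t)]| dt → 0`, from the Constantin–E–Titi estimate F₂
  `Torus.abs_cetFlux_le_eLocDiffModulus_holds` (CCFS Prop. 3.2 and (13); the estimate itself is
  the tree's `Torus.abs_integral_flux_vecMollify_le`, `FunctionSpaces/TorusCommutatorEstimate`)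
  by dominated convergence;
* F₄ `Torus.tendsto_lintegral_kineticEnergy_vecConv_sub_holds` (`OnsagerCCFSEnergyProofs`):
  `∫₀ᵀ |E(u(t) ⋆ K_ε) - E(u(t))| dt → 0`.

As corollaries (the reductions are already in `Onsager`; the Constantin–E–Titi form
`Literature.Analysis.FluidPDE.onsager_rigidity` itself is discharged independently, by the CET route, in
`OnsagerProofs`: `Literature.Analysis.FluidPDE.onsager_rigidity_holds`): the Hölder form
`Literature.Analysis.FluidPDE.onsager_rigidity_holder_holds` (`Turb.onsager_rigidity_of_ccfs`,
`Turb.onsager_rigidity_holder_of'`) and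
`Literature.Analysis.FluidPDE.conservesEnergyAEOn_of_memL3tBesovThirdVanishing_holds`.

## References

* A. Cheskidov, P. Constantin, S. Friedlander, R. Shvydkoy, *Energy conservation and Onsager's
  conjecture for the Euler equations*, Nonlinearity 21 (2008) 1233–1252 = arXiv:0704.0759, §3.2,
  Thm 3.3.
* P. Constantin, W. E, E. S. Titi, *Onsager's conjecture on the energy conservation for solutions
  of Euler's equation*, Comm. Math. Phys. 165 (1994), 207–209.
-/

noncomputable section

namespace Literature.Analysis.FluidPDE

section Turb

/-- **Sharp Onsager rigidity on `T³`** (Cheskidov–Constantin–Friedlander–Shvydkoy 2008,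
Thm 3.3, first sentence): weak Euler solutions in `L³_t B^{1/3}_{3,c₀}` conserve energy (a.e. in
time). Discharge of the named fact `onsager_rigidity_ccfs`. [cite: CCFS2008, Thm 3.3] -/
theorem onsager_rigidity_ccfs_holds : onsager_rigidity_ccfs :=
  onsager_rigidity_ccfs_of Torus.energyBalance_vecConv_holds Torus.tendsto_lintegral_cetFlux_holds
    Torus.tendsto_lintegral_kineticEnergy_vecConv_sub_holds

/-- **Onsager rigidity, Hölder form** (`α > 1/3`, `L³_t C^α_x`; Constantin–E–Titi 1994, the
remark after the Theorem, p. 207): discharge of the named fact `onsager_rigidity_holder` through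
the sharp CCFS class — `onsager_rigidity_of_ccfs` (`L³_t B^α_{3,∞} ⊂ L³_t B^{1/3}_{3,c₀}` for
`α > 1/3`) and `onsager_rigidity_holder_of'` (`L³_t C^α ⊂ L³_t B^α_{3,∞}`), both in `Onsager`.
(Equally `onsager_rigidity_holder_of' onsager_rigidity_holds` with the Constantin–E–Titi route of
`OnsagerProofs`.) [cite: ConstantinETiti1994, Theorem p. 207 and the remark following it] -/
theorem onsager_rigidity_holder_holds : onsager_rigidity_holder :=
  onsager_rigidity_holder_of' (onsager_rigidity_of_ccfs onsager_rigidity_ccfs_holds)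

/-- Discharge of `conservesEnergyAEOn_of_memL3tBesovThirdVanishing` (`onsager_rigidity_ccfs` read
through `ConservesEnergyAEOn`). [cite: CCFS2008, Thm 3.3] -/
theorem conservesEnergyAEOn_of_memL3tBesovThirdVanishing_holds {T : ℝ}
    {u : ℝ → UnitAddTorus (Fin 3) → EuclideanSpace ℝ (Fin 3)} :
    conservesEnergyAEOn_of_memL3tBesovThirdVanishing (T := T) (u := u) :=
  conservesEnergyAEOn_of_memL3tBesovThirdVanishing_of onsager_rigidity_ccfs_holds

end Turb

end Literature.Analysis.FluidPDE
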